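import Summits.Schanuel.Schanuel.Theorems.RootDecomp1KTwoBaseCell02

/-!
# RootDecomp1KTwoBaseCell — lens 1, generation 36 «TWO-BASE WALL CELL of 33364» (RootDecomp1KTwoBaseCell.lean f6aad3c3…, 1847 l) — continuation (RootDecomp1KTwoBaseCell03): §4 tools (`norm_aeval_sub_aeval_le`, `growth_beats`, `lpart`/`tpart`, …)

(lens-1 g36 `RootDecomp1KTwoBaseCell.lean`, sha256 f6aad3c3…cd39, own farm rc 0 · 0 sorry · axioms std; critic VERDICT STATUS L1729 PORT GO LOW;
port by census-1 gen 15 in nine parts `RootDecomp1KTwoBaseCell01`–`09` — see the PORT NOTE of part 01; `--supports stmt-Schanuel-33364`; rung 0.)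
-/

noncomputable section

open Complex IntermediateField Polynomial
open Summit.Schanuel.Schanuel.Theorems.RootDecomp1KHyper
open Summit.Schanuel.Schanuel.Theorems.RootDecomp1KHyper.HyperCell
open Summit.Schanuel.Schanuel.Theorems.RootDecomp1KGeneric
open Summit.Schanuel.Schanuel.Theorems.RootDecomp1KRelLiouvilleCell
open Summit.Schanuel.Schanuel.Theorems.RootDecomp1KLogLogCell (LogLogLiouville logLogLiouville_of_logSqLiouville
  logLogLiouville_of_logHyperLiouville logLogLiouville_of_hyperLiouville)

namespace Summit.Schanuel.Schanuel.Theorems.RootDecomp1KTwoBaseCell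

open LiouvilleNumber
open scoped Nat

/-! ## §4  The extraction: `MvPolyMeasure θ ⇒ AlgebraicIndependent ℚ (ℓ_{b_1}, …, ℓ_{b_k}, θ)` -/

section Tools

/-- Clearing denominators in `ℚ[X_σ]` (any index type; the tree's `exists_int_mul_eq_map` is the `Fin n` case —
same proof). -/
theorem exists_int_mul_eq_map' {σ : Type*} (g : MvPolynomial σ ℚ) :
    ∃ (N : ℤ) (G : MvPolynomial σ ℤ), N ≠ 0 ∧
      MvPolynomial.map (Int.castRingHom ℚ) G = MvPolynomial.C (N : ℚ) * g := by
  classical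
  set N : ℕ := ∏ m ∈ g.support, (g.coeff m).den with hN
  have hN0 : N ≠ 0 := Finset.prod_ne_zero_iff.mpr fun m _ => (g.coeff m).den_nz
  have hint : ∀ m ∈ g.support, ∃ z : ℤ, (z : ℚ) = (N : ℚ) * g.coeff m := by
    intro m hm
    refine ⟨(∏ m' ∈ g.support.erase m, ((g.coeff m').den : ℤ)) * (g.coeff m).num, ?_⟩
    have h1 : (N : ℚ) = (∏ m' ∈ g.support.erase m, ((g.coeff m').den : ℚ)) * (g.coeff m).den := by
      rw [hN, ← Finset.prod_erase_mul _ _ hm]; push_cast; ring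
    have h2 : ((g.coeff m).den : ℚ) * g.coeff m = (g.coeff m).num := by
      rw [mul_comm]; exact Rat.mul_den_eq_num _
    rw [h1, mul_assoc, h2]; push_cast; ring
  choose! z hz using hint
  refine ⟨N, ∑ m ∈ g.support, MvPolynomial.monomial m (z m), by exact_mod_cast hN0, ?_⟩
  rw [map_sum]
  simp only [MvPolynomial.map_monomial]
  conv_rhs => rw [← g.support_sum_monomial_coeff, Finset.mul_sum]
  refine Finset.sum_congr rfl fun m hm => ?_
  rw [eq_intCast, hz m hm, Int.cast_natCast, MvPolynomial.C_mul_monomial]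

/-- No non-trivial INTEGER relation ⇒ algebraically independent over `ℚ` (any index type; the tree's
`algebraicIndependent_of_forall_int` is the `Fin n` case — same proof). -/
theorem algebraicIndependent_of_forall_int' {σ : Type*} {u : σ → ℂ}
    (h : ∀ G : MvPolynomial σ ℤ, G ≠ 0 → MvPolynomial.aeval u G ≠ 0) :
    AlgebraicIndependent ℚ u := by
  rw [algebraicIndependent_iff]
  intro g hg
  obtain ⟨N, G, hN, hG⟩ := exists_int_mul_eq_map' g
  by_contra hg0
  have hG0 : G ≠ 0 := by
    intro h0
    rw [h0, map_zero, eq_comm, mul_eq_zero] at hG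
    rcases hG with h | h
    · exact hN (by exact_mod_cast (MvPolynomial.C_eq_zero.mp h))
    · exact hg0 h
  have hval : MvPolynomial.aeval u G = 0 := by
    have e : MvPolynomial.aeval u (MvPolynomial.map (Int.castRingHom ℚ) G) = MvPolynomial.aeval u G := by
      rw [show Int.castRingHom ℚ = algebraMap ℤ ℚ from rfl, MvPolynomial.aeval_map_algebraMap]
    rw [← e, hG, map_mul, hg, mul_zero]
  exact h G hG0 hval

/-- `‖x^n − y^n‖ ≤ n R^n δ` for `‖x‖, ‖y‖ ≤ R` (`R ≥ 1`), `‖x − y‖ ≤ δ`. -/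
theorem norm_pow_sub_pow_le' {x y : ℂ} {R δ : ℝ} (hR : 1 ≤ R) (hx : ‖x‖ ≤ R) (hy : ‖y‖ ≤ R)
    (hxy : ‖x - y‖ ≤ δ) (n : ℕ) : ‖x ^ n - y ^ n‖ ≤ n * R ^ n * δ := by
  have hδ : 0 ≤ δ := (norm_nonneg _).trans hxy
  have hR0 : 0 ≤ R := by linarith
  induction n with
  | zero => simp
  | succ n ih =>
    have e : x ^ (n + 1) - y ^ (n + 1) = x * (x ^ n - y ^ n) + (x - y) * y ^ n := by ring
    rw [e]
    have h1 : ‖x * (x ^ n - y ^ n)‖ ≤ R * (n * R ^ n * δ) := by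
      rw [norm_mul]; exact mul_le_mul hx ih (norm_nonneg _) hR0
    have h2 : ‖(x - y) * y ^ n‖ ≤ δ * R ^ n := by
      rw [norm_mul, norm_pow]
      exact mul_le_mul hxy (pow_le_pow_left₀ (norm_nonneg _) hy n) (by positivity) hδ
    have h3 : R ^ n ≤ R ^ (n + 1) := pow_le_pow_right₀ hR (Nat.le_succ n)
    calc ‖x * (x ^ n - y ^ n) + (x - y) * y ^ n‖
        ≤ R * (n * R ^ n * δ) + δ * R ^ n := (norm_add_le _ _).trans (add_le_add h1 h2)
      _ = (n * R ^ (n + 1) + R ^ n) * δ := by ring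
      _ ≤ (n * R ^ (n + 1) + R ^ (n + 1)) * δ := by gcongr
      _ = ((n + 1 : ℕ) : ℝ) * R ^ (n + 1) * δ := by push_cast; ring

/-- `‖∏ xᵢ^{eᵢ} − ∏ yᵢ^{eᵢ}‖ ≤ (Σ eᵢ) R^{Σ eᵢ} δ` (telescoping). -/
theorem norm_prod_pow_sub_prod_pow_le {ι : Type*} [DecidableEq ι] (s : Finset ι) {x y : ι → ℂ} (e : ι → ℕ)
    {R δ : ℝ} (hR : 1 ≤ R) (hδ : 0 ≤ δ) (hx : ∀ i, ‖x i‖ ≤ R) (hy : ∀ i, ‖y i‖ ≤ R)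
    (hxy : ∀ i, ‖x i - y i‖ ≤ δ) :
    ‖∏ i ∈ s, x i ^ e i - ∏ i ∈ s, y i ^ e i‖ ≤ (∑ i ∈ s, e i : ℕ) * R ^ (∑ i ∈ s, e i) * δ := by
  have hR0 : 0 ≤ R := by linarith
  induction s using Finset.induction_on with
  | empty => simp
  | insert a s ha ih =>
    rw [Finset.prod_insert ha, Finset.prod_insert ha, Finset.sum_insert ha]
    set u := x a ^ e a
    set u' := y a ^ e a
    set v := ∏ i ∈ s, x i ^ e i
    set v' := ∏ i ∈ s, y i ^ e i
    set E := ∑ i ∈ s, e i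
    have eq1 : u * v - u' * v' = u * (v - v') + (u - u') * v' := by ring
    have hu : ‖u‖ ≤ R ^ e a := by rw [norm_pow]; exact pow_le_pow_left₀ (norm_nonneg _) (hx a) _
    have hv' : ‖v'‖ ≤ R ^ E := by
      refine (Finset.norm_prod_le _ _).trans ?_
      rw [← Finset.prod_pow_eq_pow_sum]
      refine Finset.prod_le_prod (fun i _ => norm_nonneg _) fun i _ => ?_
      rw [norm_pow]; exact pow_le_pow_left₀ (norm_nonneg _) (hy i) _
    have huu' : ‖u - u'‖ ≤ e a * R ^ e a * δ := norm_pow_sub_pow_le' hR (hx a) (hy a) (hxy a) (e a)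
    rw [eq1]
    calc ‖u * (v - v') + (u - u') * v'‖
        ≤ ‖u‖ * ‖v - v'‖ + ‖u - u'‖ * ‖v'‖ := by
          refine (norm_add_le _ _).trans (add_le_add ?_ ?_) <;> rw [norm_mul]
      _ ≤ R ^ e a * ((E : ℝ) * R ^ E * δ) + (e a * R ^ e a * δ) * R ^ E :=
          add_le_add (mul_le_mul hu ih (norm_nonneg _) (by positivity))
            (mul_le_mul huu' hv' (norm_nonneg _) (by positivity))
      _ = ((e a + E : ℕ) : ℝ) * R ^ (e a + E) * δ := by push_cast; ring

/-- **Lipschitz bound for integer polynomials:** `‖P(x) − P(y)‖ ≤ (Σ|coeff|) · d · R^d · δ`. -/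
theorem norm_aeval_sub_aeval_le {σ : Type*} [Fintype σ] [DecidableEq σ] (P : MvPolynomial σ ℤ)
    {x y : σ → ℂ} {R δ : ℝ} (hR : 1 ≤ R) (hδ : 0 ≤ δ) (hx : ∀ i, ‖x i‖ ≤ R) (hy : ∀ i, ‖y i‖ ≤ R)
    (hxy : ∀ i, ‖x i - y i‖ ≤ δ) {d : ℕ} (hd : P.totalDegree ≤ d) :
    ‖MvPolynomial.aeval x P - MvPolynomial.aeval y P‖ ≤
      (∑ e ∈ P.support, |((P.coeff e : ℤ) : ℝ)|) * ((d : ℝ) * R ^ d * δ) := by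
  have hR0 : 0 ≤ R := by linarith
  rw [MvPolynomial.aeval_def, MvPolynomial.aeval_def, MvPolynomial.eval₂_eq', MvPolynomial.eval₂_eq',
    ← Finset.sum_sub_distrib, Finset.sum_mul]
  refine (norm_sum_le _ _).trans (Finset.sum_le_sum fun e he => ?_)
  rw [← mul_sub, norm_mul]
  have hc : ‖(algebraMap ℤ ℂ) (P.coeff e)‖ = |((P.coeff e : ℤ) : ℝ)| := by
    rw [algebraMap_int_eq, eq_intCast, Complex.norm_intCast]
  rw [hc]
  refine mul_le_mul_of_nonneg_left ?_ (abs_nonneg _)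
  have hdeg : ∑ i, e i ≤ d := by
    have h1 := MvPolynomial.le_totalDegree he
    rw [Finsupp.sum_fintype _ _ (fun _ => rfl)] at h1
    exact h1.trans hd
  calc ‖∏ i, x i ^ e i - ∏ i, y i ^ e i‖
      ≤ (∑ i, e i : ℕ) * R ^ (∑ i, e i) * δ := norm_prod_pow_sub_prod_pow_le _ e hR hδ hx hy hxy
    _ ≤ (d : ℝ) * R ^ d * δ := by
        have h1 : ((∑ i, e i : ℕ) : ℝ) ≤ d := by exact_mod_cast hdeg
        have h2 : R ^ (∑ i, e i) ≤ R ^ d := pow_le_pow_right₀ hR hdeg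
        gcongr

variable {n : ℕ}

/-- `mvlen (c·X^m) ≤ |c|`. -/
private theorem mvlen_monomial_le' (m : Fin n →₀ ℕ) (c : ℤ) : mvlen (MvPolynomial.monomial m c) ≤ |c| := by
  classical
  rw [mvlen_eq_sum_of_support_subset _ MvPolynomial.support_monomial_subset, Finset.sum_singleton,
    MvPolynomial.coeff_monomial, if_pos rfl]

/-- Subadditivity of `mvlen`. -/
private theorem mvlen_add_le' (P Q : MvPolynomial (Fin n) ℤ) : mvlen (P + Q) ≤ mvlen P + mvlen Q := by
  classical
  have hs : (P + Q).support ⊆ P.support ∪ Q.support := MvPolynomial.support_add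
  rw [mvlen_eq_sum_of_support_subset _ hs,
    mvlen_eq_sum_of_support_subset P (Finset.subset_union_left (s₂ := Q.support)),
    mvlen_eq_sum_of_support_subset Q (Finset.subset_union_right (s₁ := P.support)),
    ← Finset.sum_add_distrib]
  exact Finset.sum_le_sum fun m _ => by rw [MvPolynomial.coeff_add]; exact abs_add_le _ _

/-- `mvlen (Σ F_i) ≤ Σ mvlen F_i`. -/
private theorem mvlen_sum_le' {ι : Type*} (s : Finset ι) (F : ι → MvPolynomial (Fin n) ℤ) :
    mvlen (∑ i ∈ s, F i) ≤ ∑ i ∈ s, mvlen (F i) := by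
  classical
  induction s using Finset.induction_on with
  | empty => simp [mvlen]
  | insert a s ha ih =>
    rw [Finset.sum_insert ha, Finset.sum_insert ha]
    exact (mvlen_add_le' _ _).trans (by linarith)

/-- The final arithmetic: `A₀ G^{N!} < 2^{(N+1)!}` once `G ≤ 2^N` and `A₀ < 2^N`. -/
theorem growth_beats {A₀ : ℝ} {G N : ℕ} (hG : G ≤ 2 ^ N) (hA : A₀ < 2 ^ N) :
    A₀ * (G : ℝ) ^ N.factorial < (2 : ℝ) ^ (N + 1).factorial := by
  have h1 : (2 : ℝ) ^ (N + 1).factorial = (2 * 2 ^ N) ^ N.factorial := by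
    rw [Nat.factorial_succ, pow_mul, pow_succ']
  rw [h1, mul_pow]
  have hGR : (G : ℝ) ^ N.factorial ≤ (2 ^ N : ℝ) ^ N.factorial := by
    exact pow_le_pow_left₀ (by positivity) (by exact_mod_cast hG) _
  have h2N : (2 : ℝ) ^ N ≤ 2 ^ N.factorial := pow_le_pow_right₀ (by norm_num) (Nat.self_le_factorial N)
  have hpos : (0 : ℝ) < (2 ^ N : ℝ) ^ N.factorial := by positivity
  rcases le_or_gt A₀ 0 with hA0 | hA0
  · calc A₀ * (G : ℝ) ^ N.factorial ≤ 0 := mul_nonpos_of_nonpos_of_nonneg hA0 (by positivity)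
      _ < _ := by positivity
  · calc A₀ * (G : ℝ) ^ N.factorial ≤ A₀ * (2 ^ N : ℝ) ^ N.factorial :=
          mul_le_mul_of_nonneg_left hGR hA0.le
      _ < 2 ^ N.factorial * (2 ^ N : ℝ) ^ N.factorial := by
          exact mul_lt_mul_of_pos_right (lt_of_lt_of_le hA h2N) hpos

end Tools

end Summit.Schanuel.Schanuel.Theorems.RootDecomp1KTwoBaseCell
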